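import Summits.ResolutionOfSingularities.ResolutionOfSingularities.Theorems.PurelyInseparableDim4JointForestRootNormalised
import Summits.ResolutionOfSingularities.ResolutionOfSingularities.Theorems.PurelyInseparableDim4JointLeafPointCharts
import HarnessLib

/-!
# Purely inseparable four-folds: the first MIXED coordinate∘point instance of the joint forest — `z^p + x₁^p·Q`,
# `Q = x₁^p x₂ + x₂^p x₃ + x₃^p x₄ + x₄^p x₁` (`p ≥ 3`), is order-reduced by blowing up the 3-fold `V(z, x₁)` and then ONE
# POINT of its exceptional divisor (brick S3 (c) «joint point∘coordinate chains», part 24c, cell `res-dim4-pi`)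

[OURS · counted 0] (D-0157 DOOR 2; desk WORD #66 (4)(c), #74 (g), #99 (d); frame `PIDim4.TerminationImpliesOrderReduction`,
S3 (c); host item stmt-ResolutionOfSingularities-16155, helper). Nothing here proves resolution of singularities in
dimension ≥ 4 / characteristic `p` — NOT here, not anywhere in this programme.

`F = x₁^p·Q`, `K = K̄` of characteristic `p ≥ 3`. By part 24a: the closed order-`p` points of `z^p + F` form the 3-fold `{x₁ = 0}` — ONE
initial member `(0, {x₁})`; in the `x₁`-chart the transform is `Q`, whose ONLY equimultiple point on the exceptional hyperplane is the
origin — a LEAF `(x₁, 0)`, handed to the POINT regime with state `(Q, ·, ·)`; by part 24b the point blow-up of `z^p + Q` has no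
equimultiple point in any chart, so the point walk below the leaf is empty (`Acc` vacuous, no equimultiple pairs). The plan is empty;
the leaf rule is `{x₁} ↦ {(x₁, 0)}`. Hence, by part 21 (`exists_isMarkedResolution_joint_forest_root_normalised`):

* **`exists_isMarkedResolution_inst₆`** — for `3 ≤ p`, `(𝔸⁵_K, (z^p + x₁^p(x₁^p x₂ + x₂^p x₃ + x₃^p x₄ + x₄^p x₁))·𝒪, [], p)` admits
  a marked resolution (BGMW Def. 3.1.3): a 3-fold blow-up followed by a POINT blow-up — the first kernel instance in which the
  coordinate regime HANDS a point to the point regime (the forest's leaf clauses exercised non-vacuously). UNCONDITIONAL (given `p ≥ 3`).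

AI-produced formalisation, weaker than expert review. bears_on: LADDER-RESOLUTION:D157-DOOR2 (res-dim4-pi · S3 (c) joint v2 ·
leaf instance).
-/

set_option linter.dupNamespace false -- D-0017: single-problem summit path `Summit.<S>.<S>.…` by design

noncomputable section

open MvPolynomial Finset CategoryTheory AlgebraicGeometry Opposite TopologicalSpace

namespace Summit.ResolutionOfSingularities.ResolutionOfSingularities.Theorems.PIDim4

open Literature.AlgebraicGeometry.Resolution
open Literature.AlgebraicGeometry.Resolution.Hauser2010
open Literature.AlgebraicGeometry.Resolution.AffinePointBlowup (P A γ coord Wtop ξ)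

namespace Equimultiple

section Instance₆

variable {K : Type} [Field K] {p : ℕ} [hp : Fact p.Prime] [CharP K p]

/-- **`z^p + x₁^p (x₁^p x₂ + x₂^p x₃ + x₃^p x₄ + x₄^p x₁)` ADMITS A MARKED RESOLUTION BY A 3-FOLD BLOW-UP FOLLOWED BY A POINT
BLOW-UP** (`K = K̄` of characteristic `p ≥ 3`): the monotone joint forest (normalised cover) at the root with the one initial member
`(0, {x₁})`, the EMPTY plan, and the ONE leaf `(x₁, 0)` over it, whose point walk is empty.
[cite: BierstoneGrigorievMilmanWlodarczyk2011, Def. 3.1.3] [cite: HauserPerlega2019PRIMS, §2] [cite: Hauser2010, §F] -/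
theorem exists_isMarkedResolution_inst₆ [IsAlgClosed K] [DecidableEq K] (hp3 : 3 ≤ p) :
    ∃ (X' : Scheme.{0}) (ρ : X' ⟶ P 4 K) (M' : MarkedIdeal X'),
      IsMarkedResolution (⟨hypSheaf p (X 0 ^ p * (X 0 ^ p * X 1 + X 1 ^ p * X 2 + X 2 ^ p * X 3 + X 3 ^ p * X 0) :
        MvPolynomial (Fin 4) K), [], p⟩ : MarkedIdeal (P 4 K)) ρ M' := by
  classical
  set F₀ : MvPolynomial (Fin 4) K := X 0 ^ p * (X 0 ^ p * X 1 + X 1 ^ p * X 2 + X 2 ^ p * X 3 + X 3 ^ p * X 0) with hF₀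
  have hG₀ : deletePthPowers p (PointBlowup.translate (0 : Fin 4 → K) F₀) = F₀ := by
    rw [PointBlowup.translate_zero]
    exact Literature.Barriers.ResolutionOfSingularities.HauserPerlega.deletePthPowers_eq_self isClean_inst₆
  set s₀ : State K := ⟨F₀, 0, ∅⟩ with hs₀
  set sₗ : State K := CentreBlowup.step p ({0} : Finset (Fin 4)) 0 (0 : Fin 4 → K) s₀ with hsₗ
  have hsₗF : sₗ.F = X 0 ^ p * X 1 + X 1 ^ p * X 2 + X 2 ^ p * X 3 + X 3 ^ p * X 0 := step_F_inst₆
  -- the rules: no planned child; one leaf over the 3-fold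
  let plan : State K → Finset (Fin 4) → Finset (Fin 4 × (Fin 4 → K) × Finset (Fin 4)) := fun _ _ => ∅
  let leaves : State K → Finset (Fin 4) → Finset (Fin 4 × (Fin 4 → K)) := fun _ S =>
    if S = ({0} : Finset (Fin 4)) then {((0 : Fin 4), (0 : Fin 4 → K))} else ∅
  have hplan : ∀ (s : State K) (S : Finset (Fin 4)), plan s S = ∅ := fun _ _ => rfl
  have hleaves₀ : leaves s₀ {0} = {((0 : Fin 4), (0 : Fin 4 → K))} := if_pos rfl
  -- only the root state is reachable along the (empty) plan
  have hreach : ∀ q : State K × Finset (Fin 4),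
      Relation.ReflTransGen (fun q q' : State K × Finset (Fin 4) =>
        ∃ e ∈ plan q.1 q.2, q' = (CentreBlowup.step p q.2 e.1 e.2.1 q.1, e.2.2)) (s₀, {0}) q → q = (s₀, {0}) := by
    intro q hq
    induction hq with
    | refl => rfl
    | tail _ hR _ =>
      obtain ⟨e, he, -⟩ := hR
      exact absurd he (Finset.notMem_empty e)
  have hacc₀ : Acc (fun q' q : State K × Finset (Fin 4) =>
      ∃ e ∈ plan q.1 q.2, q' = (CentreBlowup.step p q.2 e.1 e.2.1 q.1, e.2.2)) (s₀, {0}) :=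
    Acc.intro _ fun q' ⟨e, he, _⟩ => absurd he (Finset.notMem_empty e)
  refine exists_isMarkedResolution_joint_forest_root_normalised F₀ inst₆_ne_zero isClean_inst₆ plan leaves
    {((0 : Fin 4 → K), ({0} : Finset (Fin 4)))} (fun bS hbS => ?_) (fun bS hbS bS' hbS' hne => ?_)
    (Set.finite_empty.subset ?_) (fun b' H hoff => ?_)
  · -- the member `(0, {x₁})`: permissible, hereditary conditions (only the root state), `Acc`
    rw [Finset.mem_singleton] at hbS
    subst hbS
    dsimp only
    rw [hG₀]
    refine ⟨isPermissibleCentre_inst₆, fun q hq => ?_, hacc₀⟩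
    rw [hreach q hq]
    dsimp only
    rw [hleaves₀]
    refine ⟨fun e he => absurd he (Finset.notMem_empty e), fun e he => absurd he (Finset.notMem_empty e),
      fun l hl _ => ?_, fun j' b' hj' hb' _ heq => ?_⟩
    · -- the leaf: its point walk is empty
      rw [Finset.mem_singleton] at hl
      subst hl
      dsimp only
      exact ⟨acc_edge_of_F_eq_Q hp3 _ step_F_inst₆, fun s' hs' => finite_pairs_of_reflTransGen_of_F_eq_Q hp3 _ step_F_inst₆ s' hs'⟩
    · -- cover: the only equimultiple pair is the leaf
      rw [Finset.mem_singleton] at hj'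
      subst hj'
      right
      rw [eq_zero_of_isEquimultiplePoint_inst₆ hb' heq]
      exact Finset.mem_singleton_self _
  · -- one member only
    rw [Finset.mem_singleton] at hbS hbS'
    exact absurd (hbS.trans hbS'.symm) hne
  · -- no root parameter off the member
    rintro b' ⟨H, hoff⟩
    exact hoff ((0 : Fin 4 → K), {0}) (Finset.mem_singleton_self _) (fun i hi => by
      rw [Finset.mem_singleton] at hi; subst hi; exact roots_inst₆ b' H)
  · exfalso
    exact hoff ((0 : Fin 4 → K), {0}) (Finset.mem_singleton_self _) (fun i hi => by
      rw [Finset.mem_singleton] at hi; subst hi; exact roots_inst₆ b' H)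

end Instance₆

end Equimultiple

end Summit.ResolutionOfSingularities.ResolutionOfSingularities.Theorems.PIDim4

end
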